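import Summits.QuantumFields.YangMills.Theses.PencilRigidity
import Literature.MathematicalPhysics.QuantumFieldTheory.LatticeGaugeProofs
import Literature.Barriers.QuantumFields.DiscreteSubgroupFreezing

/-!
# `HypercubicLimit` — negative-side support: `0 < Δ` is load-bearing; the "all time separations"
# strengthening of `HasLatticeMassGap` is false for every non-abelian gauge group

Support file for crux `stmt-QuantumFields-8646` (`HypercubicLimit`, shared by the routes
PencilRigidity / MirrorModularBoosts / CoincidenceRotationBootstrap), extracted from the standing
disprover's work file `Cruxes/HypercubicLimit/Disproof.lean` §5/§5b.  Tree objects only, nothing posited.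

* `abs_latticeConnectedCorr_le`: `|⟨A τ_n B⟩ − ⟨A⟩⟨B⟩| ≤ 2 C_A C_B` at every coupling.
* `hasLatticeMassGap_of_nonpos`: for `Δ ≤ 0` EVERY scheme has `HasLatticeMassGap r sch Δ`.
* `latticeConnectedCorr_add_side`, `latticeConnectedCorr_add_mul_side`: torus time-correlations are periodic
  with period the side `2S+1`.
* `latticeConnectedCorr_eq_zero_of_allTimes`: the strengthening of `HasLatticeMassGap` with `n ≤ S` removed
  forces every connected torus correlation (every variance) to vanish eventually.
* `actionDensity_ne` (via `Literature.Barriers.QuantumFields.eq_one_of_re_trace_eq`) (the curvature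
  observable separates the trivial configuration from the `a/b`-direction configuration when `ab ≠ ba`),
  `isOpenPosMeasure_wilsonMeasure` (Wilson's measure charges every open set, any continuous `ρ`, any `β`),
  `variance_pos`, and `not_hasLatticeMassGapAllTimes`: the strengthening is FALSE for every non-abelian compact
  `G`, every faithful `r`, every scheme, every `Δ > 0` — the restriction `n ≤ S` in `HasLatticeMassGap` is
  essential. [folklore]
-/

noncomputable section

open scoped ComplexConjugate ComplexOrder ENNReal Matrix
open MeasureTheory Filter Topology Complex
open Literature.MathematicalPhysics.AQFT Literature.MathematicalPhysics.QuantumLattice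
open Literature.MathematicalPhysics.QuantumFieldTheory
open Literature.Probability.LatticeModels (Site Torus.proj)

namespace Summit.QuantumFields.YangMills.Theorems.HypercubicLimit.Negative

/-! ## §5 `0 < Δ` is load-bearing; periodicity kills the "all time separations" strengthening -/

section Rates

variable {G : Type} [Group G] [TopologicalSpace G] [IsTopologicalGroup G] [CompactSpace G]
  [MeasurableSpace G] [BorelSpace G]

/-- **A priori bound**: connected torus correlations of bounded observables are bounded by
`2 C_A C_B`, at every coupling (Wilson's measure is a probability measure for continuous `ρ`). [folklore] -/
theorem abs_latticeConnectedCorr_le (r : LatticeRep G) (β : ℝ) (S : ℕ) [NeZero S]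
    {A B : LGConfig 4 G → ℝ} {CA CB : ℝ} (hA : ∀ U, |A U| ≤ CA) (hB : ∀ U, |B U| ≤ CB) (n : ℕ) :
    |latticeConnectedCorr r.ρ β S A B n| ≤ 2 * (CA * CB) := by
  haveI := isProbabilityMeasure_wilsonMeasure (d := 4) (L := S) r.ρ r.continuous β
  have hCA0 : 0 ≤ CA := le_trans (abs_nonneg _) (hA fun _ => 1)
  have hb1 : ‖∫ U, A (torusLift S U) * B (configShift (-Pi.single 0 (n : ℤ)) (torusLift S U))
      ∂(wilsonMeasure (d := 4) (L := S) r.ρ β)‖ ≤ CA * CB := by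
    refine (norm_integral_le_of_norm_le_const (C := CA * CB) ?_).trans (by simp)
    refine Eventually.of_forall fun U => ?_
    rw [norm_mul, Real.norm_eq_abs, Real.norm_eq_abs]
    exact mul_le_mul (hA _) (hB _) (abs_nonneg _) hCA0
  have hb2 : ‖∫ U, A (torusLift S U) ∂(wilsonMeasure (d := 4) (L := S) r.ρ β)‖ ≤ CA := by
    refine (norm_integral_le_of_norm_le_const (C := CA) ?_).trans (by simp)
    exact Eventually.of_forall fun U => by rw [Real.norm_eq_abs]; exact hA _
  have hb3 : ‖∫ U, B (torusLift S U) ∂(wilsonMeasure (d := 4) (L := S) r.ρ β)‖ ≤ CB := by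
    refine (norm_integral_le_of_norm_le_const (C := CB) ?_).trans (by simp)
    exact Eventually.of_forall fun U => by rw [Real.norm_eq_abs]; exact hB _
  unfold latticeConnectedCorr
  rw [← Real.norm_eq_abs]
  refine (norm_sub_le _ _).trans ?_
  rw [norm_mul]
  have := mul_le_mul hb2 hb3 (norm_nonneg _) hCA0
  linarith

/-- **`0 < Δ` is load-bearing**: for `Δ ≤ 0` EVERY scheme has `HasLatticeMassGap r sch Δ`
(the bound `C e^{-Δ a_k n} ≥ C` is implied by boundedness of the observables). [folklore] -/
theorem hasLatticeMassGap_of_nonpos {ι : Type} (r : LatticeRep G) (sch : SpeciesScheme ι) {Δ : ℝ}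
    (hΔ : Δ ≤ 0) : HasLatticeMassGap r sch Δ := by
  intro A B
  obtain ⟨CA, hCA⟩ := A.bounded
  obtain ⟨CB, hCB⟩ := B.bounded
  refine ⟨2 * (CA * CB), Eventually.of_forall fun k S _ n _ => ?_⟩
  refine (abs_latticeConnectedCorr_le r (sch.β k) (2 * S + 1) hCA hCB n).trans ?_
  have h2 : 0 ≤ 2 * (CA * CB) :=
    le_trans (abs_nonneg _) (abs_latticeConnectedCorr_le r (sch.β k) (2 * S + 1) hCA hCB n)
  have hexp : 1 ≤ Real.exp (-(Δ * (sch.a k * n))) := by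
    rw [Real.one_le_exp_iff]
    have : 0 ≤ sch.a k * n := mul_nonneg (sch.a_pos k).le (Nat.cast_nonneg _)
    nlinarith
  calc 2 * (CA * CB) = 2 * (CA * CB) * 1 := (mul_one _).symm
    _ ≤ 2 * (CA * CB) * Real.exp (-(Δ * (sch.a k * n))) := mul_le_mul_of_nonneg_left hexp h2

omit [TopologicalSpace G] [IsTopologicalGroup G] [CompactSpace G] [BorelSpace G] [Group G] in
/-- **Periodicity of the shifted lift**: shifting by a full period of the torus in the time
direction changes nothing. [folklore] -/
theorem configShift_torusLift_add_period (L : ℕ) (U : GaugeConfig 4 L G) (n : ℕ) :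
    configShift (-Pi.single 0 ((n + L : ℕ) : ℤ)) (torusLift L U) =
      configShift (-Pi.single 0 (n : ℤ)) (torusLift L U) := by
  funext e
  simp only [Literature.MathematicalPhysics.QuantumLattice.configShift_apply, torusLift,
    Function.comp_apply, torusEdge]
  congr 2
  funext i
  simp only [Literature.Probability.LatticeModels.Torus.proj_apply, Pi.sub_apply, Pi.neg_apply]
  by_cases hi : i = 0
  · subst hi; simp
  · simp [Pi.single_eq_of_ne hi]

/-- **Torus time-correlations are periodic** with period the side of the torus. [folklore] -/
theorem latticeConnectedCorr_add_side {N : ℕ} (ρ : G →* Matrix (Fin N) (Fin N) ℂ) (β : ℝ)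
    (L : ℕ) [NeZero L] (A B : LGConfig 4 G → ℝ) (n : ℕ) :
    latticeConnectedCorr ρ β L A B (n + L) = latticeConnectedCorr ρ β L A B n := by
  unfold latticeConnectedCorr
  simp_rw [configShift_torusLift_add_period]

/-- Iterated periodicity. [folklore] -/
theorem latticeConnectedCorr_add_mul_side {N : ℕ} (ρ : G →* Matrix (Fin N) (Fin N) ℂ) (β : ℝ)
    (L : ℕ) [NeZero L] (A B : LGConfig 4 G → ℝ) (n m : ℕ) :
    latticeConnectedCorr ρ β L A B (n + m * L) = latticeConnectedCorr ρ β L A B n := by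
  induction m with
  | zero => simp
  | succ m ih => rw [Nat.succ_mul, ← add_assoc, latticeConnectedCorr_add_side, ih]

/-- **The all-times strengthening of `HasLatticeMassGap` (the restriction `n ≤ S` on the time separation
removed) is degenerate**: by periodicity it forces EVERY connected
torus correlation of every pair of gauge-invariant observables — in particular every variance
(`n = 0`) — to vanish on all large tori for all large `k`: the lattice states would have to be
deterministic on gauge-invariant observables.  (With any observable of positive variance, e.g. a
plaquette under the fully supported Wilson measure, it is outright false; the restriction `n ≤ S`
in `HasLatticeMassGap` is exactly what avoids this.) [folklore] -/
theorem latticeConnectedCorr_eq_zero_of_allTimes {ι : Type} {r : LatticeRep G} {sch : SpeciesScheme ι}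
    {Δ : ℝ} (hΔ : 0 < Δ) (h : (∀ A B : YMSpecies G, ∃ C : ℝ, ∀ᶠ k in atTop, ∀ S : ℕ, sch.L k ≤ S → ∀ n : ℕ,
      |latticeConnectedCorr r.ρ (sch.β k) (2 * S + 1) A.F B.F n| ≤ C * Real.exp (-(Δ * (sch.a k * n))))) (A B : YMSpecies G) :
    ∀ᶠ k in atTop, ∀ S : ℕ, sch.L k ≤ S → ∀ n : ℕ,
      latticeConnectedCorr r.ρ (sch.β k) (2 * S + 1) A.F B.F n = 0 := by
  obtain ⟨C, hC⟩ := h A B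
  filter_upwards [hC] with k hk S hS n
  have hrate : 0 < Δ * (sch.a k * (2 * S + 1 : ℕ)) :=
    mul_pos hΔ (mul_pos (sch.a_pos k) (by positivity))
  -- the bound along the periodic copies n + m (2S+1) tends to 0
  have hlim : Tendsto (fun m : ℕ => C * Real.exp (-(Δ * (sch.a k * ((n + m * (2 * S + 1) : ℕ) : ℝ)))))
      atTop (𝓝 0) := by
    have hexp : Tendsto (fun m : ℕ => Real.exp (-(Δ * (sch.a k * ((n + m * (2 * S + 1) : ℕ) : ℝ)))))
        atTop (𝓝 0) := by
      have h1 : Tendsto (fun m : ℕ => Δ * (sch.a k * ((n + m * (2 * S + 1) : ℕ) : ℝ))) atTop atTop := by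
        have : (fun m : ℕ => Δ * (sch.a k * ((n + m * (2 * S + 1) : ℕ) : ℝ))) =
            fun m : ℕ => Δ * (sch.a k * (2 * S + 1 : ℕ)) * (m : ℝ) + Δ * (sch.a k * n) := by
          funext m; push_cast; ring
        rw [this]
        exact tendsto_atTop_add_const_right _ _
          (Tendsto.const_mul_atTop hrate tendsto_natCast_atTop_atTop)
      exact Real.tendsto_exp_atBot.comp (tendsto_neg_atTop_atBot.comp h1)
    simpa using hexp.const_mul C
  have hbound : ∀ m : ℕ, |latticeConnectedCorr r.ρ (sch.β k) (2 * S + 1) A.F B.F n| ≤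
      C * Real.exp (-(Δ * (sch.a k * ((n + m * (2 * S + 1) : ℕ) : ℝ)))) := fun m => by
    rw [← latticeConnectedCorr_add_mul_side r.ρ (sch.β k) (2 * S + 1) A.F B.F n m]
    exact hk S hS _
  have h0 : |latticeConnectedCorr r.ρ (sch.β k) (2 * S + 1) A.F B.F n| ≤ 0 :=
    ge_of_tendsto' hlim hbound
  exact abs_eq_zero.1 (le_antisymm h0 (abs_nonneg _))

end Rates

/-! ### §5b The all-times strengthening is FALSE for every non-abelian `G` (positive variances) -/

section Variance

variable {G : Type} [Group G] [TopologicalSpace G] [IsTopologicalGroup G] [CompactSpace G]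
  [MeasurableSpace G] [BorelSpace G]

omit [TopologicalSpace G] [IsTopologicalGroup G] [CompactSpace G] [MeasurableSpace G] [BorelSpace G] in
/-- The periodic lift of the "`a` on direction 0, `b` on direction 1" torus configuration is the same
configuration on `ℤ⁴`. [folklore] -/
theorem torusLift_dirConfigT (L : ℕ) (a b : G) :
    torusLift L (fun e : Edge 4 L => if e.2 = 0 then a else if e.2 = 1 then b else (1 : G)) =
      (fun e : Literature.MathematicalPhysics.QuantumLattice.ZdEdge 4 => if e.2 = 0 then a else if e.2 = 1 then b else (1 : G)) := by
  funext e; rfl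

omit [TopologicalSpace G] [IsTopologicalGroup G] [CompactSpace G] [MeasurableSpace G] [BorelSpace G] in
/-- `torusLift_one` (auxiliary). [folklore] -/
theorem torusLift_one (L : ℕ) : torusLift L (fun _ => (1 : G)) = (fun _ => (1 : G) : LGConfig 4 G) := by
  funext e; rfl

omit [TopologicalSpace G] [IsTopologicalGroup G] [CompactSpace G] [MeasurableSpace G] [BorelSpace G] in
/-- The Wilson action density of the trivial configuration is `6N`. [folklore] -/
theorem actionDensity_const_one {N : ℕ} (ρ : G →* Matrix (Fin N) (Fin N) ℂ) :
    actionDensity ρ (fun _ => (1 : G)) = 6 * N := by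
  simp [actionDensity, plaquetteObs, plaquetteHolonomyZd, Fin.sum_univ_four, Matrix.trace_one]
  ring

omit [TopologicalSpace G] [IsTopologicalGroup G] [CompactSpace G] [MeasurableSpace G] [BorelSpace G] in
/-- The action density of the "`a` on direction 0, `b` on direction 1" configuration is
`Re tr ρ(aba⁻¹b⁻¹) + 5N`. [folklore] -/
theorem actionDensity_dirConfig {N : ℕ} (ρ : G →* Matrix (Fin N) (Fin N) ℂ) (a b : G) :
    actionDensity ρ (fun e : Literature.MathematicalPhysics.QuantumLattice.ZdEdge 4 => if e.2 = 0 then a else if e.2 = 1 then b else (1 : G)) =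
      (ρ (a * b * a⁻¹ * b⁻¹)).trace.re + 5 * N := by
  simp [actionDensity, plaquetteObs, plaquetteHolonomyZd, Fin.sum_univ_four, Matrix.trace_one]
  ring

omit [IsTopologicalGroup G] [CompactSpace G] [MeasurableSpace G] [BorelSpace G] in
/-- **For a non-abelian `G` and a faithful `ρ`, the curvature observable is not constant**. [folklore] -/
theorem actionDensity_ne (r : LatticeRep G) {a b : G} (hab : a * b ≠ b * a) :
    actionDensity r.ρ (fun e : Literature.MathematicalPhysics.QuantumLattice.ZdEdge 4 => if e.2 = 0 then a else if e.2 = 1 then b else (1 : G)) ≠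
      actionDensity r.ρ (fun _ => (1 : G)) := by
  rw [actionDensity_dirConfig, actionDensity_const_one]
  intro h
  have htr : (r.ρ (a * b * a⁻¹ * b⁻¹)).trace.re = r.N := by linarith
  have h1 : r.ρ (a * b * a⁻¹ * b⁻¹) = 1 := Literature.Barriers.QuantumFields.eq_one_of_re_trace_eq (r.mem_unitary _) htr
  have h2 : a * b * a⁻¹ * b⁻¹ = 1 := r.injective (by rw [h1, map_one])
  apply hab
  calc a * b = a * b * a⁻¹ * b⁻¹ * (b * a) := by group
    _ = b * a := by rw [h2, one_mul]

/-- **Wilson's measure charges every non-empty open set** (continuous `ρ`): the density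
`e^{-βS}` is bounded below and product Haar is positive on opens. [folklore] -/
theorem isOpenPosMeasure_wilsonMeasure {N : ℕ} (ρ : G →* Matrix (Fin N) (Fin N) ℂ)
    (hρ : Continuous ρ) (β : ℝ) (L : ℕ) [NeZero L] :
    Measure.IsOpenPosMeasure (wilsonMeasure (d := 4) (L := L) ρ β) := by
  haveI : Measure.IsOpenPosMeasure (haarProbability G) := by
    unfold haarProbability; infer_instance
  haveI hprob := isProbabilityMeasure_wilsonMeasure (d := 4) (L := L) ρ hρ β
  obtain ⟨B, hB⟩ := exists_abs_wilsonAction_le (d := 4) (L := L) ρ hρ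
  refine ⟨fun O hO hne => ?_⟩
  set π : Measure (GaugeConfig 4 L G) := Measure.pi fun _ : Edge 4 L => haarProbability G with hπ
  have hπO : π O ≠ 0 := hO.measure_ne_zero π hne
  have hZ : (partitionFunction (d := 4) (L := L) ρ β)⁻¹ ≠ 0 := by
    intro h0
    have h1 : wilsonMeasure (d := 4) (L := L) ρ β Set.univ = 1 := measure_univ
    simp [wilsonMeasure, h0] at h1
  have hw : ∀ U : GaugeConfig 4 L G,
      ENNReal.ofReal (Real.exp (-(|β| * B))) ≤ ENNReal.ofReal (Real.exp (-β * wilsonAction ρ U)) := by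
    intro U
    apply ENNReal.ofReal_le_ofReal
    apply Real.exp_le_exp.2
    have h1 : β * wilsonAction ρ U ≤ |β * wilsonAction ρ U| := le_abs_self _
    have h2 : |β * wilsonAction ρ U| ≤ |β| * B := by
      rw [abs_mul]; exact mul_le_mul_of_nonneg_left (hB U) (abs_nonneg _)
    linarith
  have hlow : ENNReal.ofReal (Real.exp (-(|β| * B))) * π O ≤ wilsonWeight (d := 4) (L := L) ρ β O := by
    calc ENNReal.ofReal (Real.exp (-(|β| * B))) * π O
        = ∫⁻ _ in O, ENNReal.ofReal (Real.exp (-(|β| * B))) ∂π := (setLIntegral_const _ _).symm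
      _ ≤ ∫⁻ U in O, ENNReal.ofReal (Real.exp (-β * wilsonAction ρ U)) ∂π := lintegral_mono fun U => hw U
      _ ≤ wilsonWeight (d := 4) (L := L) ρ β O := withDensity_apply_le _ _
  have hpos : wilsonWeight (d := 4) (L := L) ρ β O ≠ 0 := by
    refine ne_of_gt (lt_of_lt_of_le ?_ hlow)
    exact ENNReal.mul_pos (ENNReal.ofReal_pos.2 (Real.exp_pos _)).ne' hπO
  simp only [wilsonMeasure, Measure.smul_apply, smul_eq_mul, ne_eq, mul_eq_zero, hZ, hpos, or_self,
    not_false_eq_true]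

omit [MeasurableSpace G] [BorelSpace G] [Group G] [IsTopologicalGroup G] in
/-- A continuous observable of torus configurations has compact support (compact space). [folklore] -/
theorem hasCompactSupport_of_gaugeConfig {L : ℕ} (f : GaugeConfig 4 L G → ℝ) : HasCompactSupport f :=
  (isClosed_tsupport f).isCompact

/-- **Positive variance**: under any Wilson measure (continuous faithful `ρ`), a continuous
observable taking two different values has `∫ P² − (∫ P)² > 0`. [folklore] -/
theorem variance_pos (r : LatticeRep G) (β : ℝ) (L : ℕ) [NeZero L]
    {P : GaugeConfig 4 L G → ℝ} (hP : Continuous P) {U V : GaugeConfig 4 L G} (hUV : P U ≠ P V) :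
    0 < ∫ W, P W * P W ∂(wilsonMeasure (d := 4) (L := L) r.ρ β) -
      (∫ W, P W ∂(wilsonMeasure (d := 4) (L := L) r.ρ β)) *
        ∫ W, P W ∂(wilsonMeasure (d := 4) (L := L) r.ρ β) := by
  haveI : SecondCountableTopology G :=
    (r.continuous.isClosedEmbedding r.injective).isEmbedding.secondCountableTopology
  haveI := isProbabilityMeasure_wilsonMeasure (d := 4) (L := L) r.ρ r.continuous β
  haveI := isOpenPosMeasure_wilsonMeasure (G := G) r.ρ r.continuous β L
  set μ := wilsonMeasure (d := 4) (L := L) r.ρ β with hμ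
  set c : ℝ := ∫ W, P W ∂μ with hc
  have hg : Continuous fun W => (P W - c) ^ 2 := by fun_prop
  have hint : Integrable P μ := hP.integrable_of_hasCompactSupport (hasCompactSupport_of_gaugeConfig P)
  have hint2 : Integrable (fun W => P W * P W) μ :=
    (hP.mul hP).integrable_of_hasCompactSupport (hasCompactSupport_of_gaugeConfig _)
  -- some point where the centred square is non-zero
  have hx : ∃ X, (P X - c) ^ 2 ≠ 0 := by
    by_contra hall
    push Not at hall
    have hU := hall U
    have hV := hall V
    rw [sq_eq_zero_iff, sub_eq_zero] at hU hV
    exact hUV (hU.trans hV.symm)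
  obtain ⟨X, hX⟩ := hx
  have hpos : 0 < ∫ W, (P W - c) ^ 2 ∂μ :=
    hg.integral_pos_of_hasCompactSupport_nonneg_nonzero (hasCompactSupport_of_gaugeConfig _)
      (fun W => sq_nonneg _) hX
  have hexpand : ∫ W, (P W - c) ^ 2 ∂μ = ∫ W, P W * P W ∂μ - c * c := by
    have h1 : (fun W => (P W - c) ^ 2) = fun W => P W * P W - (2 * c) * P W + c ^ 2 := by
      funext W; ring
    have e2 : ∫ W, (P W * P W - (2 * c) * P W + c ^ 2) ∂μ =
        (∫ W, P W * P W ∂μ - ∫ W, (2 * c) * P W ∂μ) + ∫ _W, c ^ 2 ∂μ := by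
      rw [integral_add (f := fun W => P W * P W - (2 * c) * P W) (g := fun _ => c ^ 2)
        (hint2.sub (hint.const_mul _)) (integrable_const _),
        integral_sub (f := fun W => P W * P W) (g := fun W => (2 * c) * P W) hint2 (hint.const_mul _)]
    rw [h1, e2, integral_const_mul, integral_const, smul_eq_mul, probReal_univ, ← hc]
    ring
  linarith

/-- `latticeConnectedCorr` at time separation `0` is the variance-type quantity. [folklore] -/
theorem latticeConnectedCorr_zero_time {N : ℕ} (ρ : G →* Matrix (Fin N) (Fin N) ℂ) (β : ℝ)
    (L : ℕ) [NeZero L] (A : LGConfig 4 G → ℝ) :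
    latticeConnectedCorr ρ β L A A 0 =
      ∫ W, A (torusLift L W) * A (torusLift L W) ∂(wilsonMeasure (d := 4) (L := L) ρ β) -
        (∫ W, A (torusLift L W) ∂(wilsonMeasure (d := 4) (L := L) ρ β)) *
          ∫ W, A (torusLift L W) ∂(wilsonMeasure (d := 4) (L := L) ρ β) := by
  unfold latticeConnectedCorr
  have h0 : ∀ W : LGConfig 4 G, configShift (-Pi.single (0 : Fin 4) ((0 : ℕ) : ℤ)) W = W := by
    intro W; funext e
    simp [Literature.MathematicalPhysics.QuantumLattice.configShift_apply]
  simp_rw [h0]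

/-- **The all-times strengthening of `HasLatticeMassGap` is FALSE for every non-abelian compact
`G`, every faithful `r`, every scheme and every `Δ > 0`**: the curvature observable has positive
variance under every Wilson measure (fully supported), while the strengthening forces the
variance to vanish (periodicity, §5).  In particular replacing `HasLatticeMassGap` by it kills the
crux for EVERY compact simple Lie group. [folklore] -/
theorem not_hasLatticeMassGapAllTimes {ι : Type} (hG : ∃ a b : G, a * b ≠ b * a) (r : LatticeRep G)
    (sch : SpeciesScheme ι) {Δ : ℝ} (hΔ : 0 < Δ) :
    ¬ (∀ A B : YMSpecies G, ∃ C : ℝ, ∀ᶠ k in atTop, ∀ S : ℕ, sch.L k ≤ S → ∀ n : ℕ,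
      |latticeConnectedCorr r.ρ (sch.β k) (2 * S + 1) A.F B.F n| ≤ C * Real.exp (-(Δ * (sch.a k * n)))) := by
  intro h
  obtain ⟨a, b, hab⟩ := hG
  obtain ⟨k, hk⟩ := (latticeConnectedCorr_eq_zero_of_allTimes hΔ h r.curvature r.curvature).exists
  have h0 := hk (sch.L k) le_rfl 0
  rw [latticeConnectedCorr_zero_time] at h0
  have hP : Continuous fun W : GaugeConfig 4 (2 * sch.L k + 1) G =>
      r.curvature.F (torusLift (2 * sch.L k + 1) W) :=
    (continuous_actionDensity r.continuous).comp (continuous_pi fun _ => continuous_apply _)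
  have hne : r.curvature.F (torusLift (2 * sch.L k + 1)
      (fun e : Edge 4 (2 * sch.L k + 1) => if e.2 = 0 then a else if e.2 = 1 then b else (1 : G))) ≠
      r.curvature.F (torusLift (2 * sch.L k + 1) (fun _ => 1)) := by
    rw [torusLift_dirConfigT, torusLift_one]
    exact actionDensity_ne r hab
  have hvar := variance_pos r (sch.β k) (2 * sch.L k + 1) hP hne
  linarith


end Variance

end Summit.QuantumFields.YangMills.Theorems.HypercubicLimit.Negative
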